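import Mathlib
import Literature.Probability.Percolation.CLE6Tightness
import Literature.Probability.Percolation.FullPlaneCNLProofs
import Literature.Probability.Percolation.SiteInterfaceStructure
import Literature.Probability.Percolation.SiteNestingWeightBound
import HarnessLib

/-!
# Soft machine, brick 3: typed windowed loop collections of site-`𝕋` — tightness, finiteness, locality

Crux `Summit.CriticalPhenomena.CardyFormulaZ2.Theses.CardyMagicRigidity.NestingRigidity`
(stmt-CriticalPhenomena-4835), line `positive-cone-weight-doubling`, registered stub `stub_tamePrecompactness`
(SOFT MACHINE ⇒ T1m for `tEns`).  The Aizenman–Burchard tightness in the tree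
(`isTightLaws_map_triLoopCollection_holds`, `CLE6Tightness.lean`) concerns the UNTYPED collection of interface loops
of the configuration restricted to a Jordan domain.  DKKMO's `d_CN` compares loops TYPE BY TYPE (type `1` =
counter-clockwise, positive shoelace sum), in growing WINDOWS `B(0, 1/ε)`.  This file supplies the lattice objects
the machine consumes:

* the TYPED WINDOWED objects, written inline throughout (no definition is introduced): the generating set
  `G(r, i, δ, ω) = {siteLoopCurve δ γ | γ interface loop of ω ∩ triMeshVertices (ball 0 r) δ of type i}` of classes
  of the interface loops OF TYPE `i` (`1` = counter-clockwise = positive shoelace sum, as in `siteLoopConfig`) of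
  the configuration restricted to the disc window `B(0, r)` (sites outside closed), and the closed collection
  `Closeds.closure G(r, i, δ, ω) : LoopSpace ℂ` it generates;
* finiteness at positive mesh (`finite_siteWinGen`: an interface loop is determined by its base face,
  `IsSiteInterfaceLoop.eq_of_base_eq`, and the faces lie in a bounded set), so the collection IS the generating
  set (`coe_siteWinColl`), a compact set of loops; dependence on finitely many sites only, whence measurability
  and finite range at fixed mesh (`measurable_and_finite_range_siteWinColl`);
* **tightness** of the laws of the typed windowed collections, `δ ∈ (0, 1]`, on the Aizenman–Burchard space
  (`softMachine_isTightLaws_siteWinColl`, registered anchor) — the typed sub-collections are generated by the same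
  system of interface polygons, to which the AB criterion `LoopSpace.isTightLaws_map_of_traversalBounds` applies
  verbatim ((H0) `IsSiteInterfaceLoop.not_hasTraversals_of_le`, (H1) `triSitePercolation_exists_loop_hasTraversals_le`);
* **locality** (`exists_mem_siteWinColl_of_mem_siteLoopConfig`, `mk_mem_siteLoopConfig_of_mem_siteWinGen`): inside
  `B(0, r − δ)` the typed members of the window collection are exactly the typed loops of the whole-plane
  configuration `siteLoopConfig δ ω` (`isSiteInterfaceLoop_inter_triMeshVertices_iff`).
-/

noncomputable section

open MeasureTheory Set Filter Metric TopologicalSpace Function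
open scoped Topology ENNReal NNReal

namespace Summit.CriticalPhenomena.CardyFormulaZ2.Cruxes.NestingRigidity.PositiveConeWeightDoubling

open Literature.Probability.RandomPlanarGeometry Literature.Probability.Percolation
  Literature.Probability.LatticeModels

namespace SoftMachine

/-! ### The typed windowed collections (inline): locality in the configuration, loops -/

/-- The generating set `G(r, i, δ, ω)` of the typed windowed collection only depends on the sites of the window. -/
theorem siteWinGen_eq_of_inter_eq {r : ℝ} {δ : ℝ} {ω ω' : SiteConfig (Site 2)}
    (h : ω ∩ triMeshVertices (ball (0 : ℂ) r) δ = ω' ∩ triMeshVertices (ball (0 : ℂ) r) δ) (i : Fin 2) :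
    {c : CurveClass ℂ | ∃ (f : HexVertex) (γ : hexGraph.Walk f f),
      IsSiteInterfaceLoop (ω ∩ triMeshVertices (ball (0 : ℂ) r) δ) γ ∧
        (i = 1 ↔ 0 < shoelace (γ.support.map hexCenter)) ∧ c = siteLoopCurve δ γ} =
    {c : CurveClass ℂ | ∃ (f : HexVertex) (γ : hexGraph.Walk f f),
      IsSiteInterfaceLoop (ω' ∩ triMeshVertices (ball (0 : ℂ) r) δ) γ ∧
        (i = 1 ↔ 0 < shoelace (γ.support.map hexCenter)) ∧ c = siteLoopCurve δ γ} := by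
  simp only [h]

/-- Every generator is a loop. -/
theorem isLoop_of_mem_siteWinGen {r : ℝ} {i : Fin 2} {δ : ℝ} {ω : SiteConfig (Site 2)} {c : CurveClass ℂ}
    (hc : c ∈ {c : CurveClass ℂ | ∃ (f : HexVertex) (γ : hexGraph.Walk f f),
      IsSiteInterfaceLoop (ω ∩ triMeshVertices (ball (0 : ℂ) r) δ) γ ∧
        (i = 1 ↔ 0 < shoelace (γ.support.map hexCenter)) ∧ c = siteLoopCurve δ γ}) : c.IsLoop := by
  obtain ⟨f, γ, -, -, rfl⟩ := hc
  exact isLoop_siteLoopCurve δ γ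

/-- Every member of the typed windowed collection `Closeds.closure G(r, i, δ, ω)` is a loop (loops form a closed
set of curve classes). -/
theorem isLoop_of_mem_siteWinColl {r : ℝ} {i : Fin 2} {δ : ℝ} {ω : SiteConfig (Site 2)} {c : CurveClass ℂ}
    (hc : c ∈ (Closeds.closure
      {c : CurveClass ℂ | ∃ (f : HexVertex) (γ : hexGraph.Walk f f),
      IsSiteInterfaceLoop (ω ∩ triMeshVertices (ball (0 : ℂ) r) δ) γ ∧
        (i = 1 ↔ 0 < shoelace (γ.support.map hexCenter)) ∧ c = siteLoopCurve δ γ} : LoopSpace ℂ)) : c.IsLoop :=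
  closure_minimal (fun _ h ↦ isLoop_of_mem_siteWinGen h) CurveClass.isClosed_setOf_isLoop hc

/-! ### Finiteness at positive mesh -/

/-- The base face of an interface loop of the window configuration lies in a bounded set of faces. -/
theorem norm_hexCenter_base_le {r δ : ℝ} (hδ : 0 < δ) {ω : SiteConfig (Site 2)} {f : HexVertex}
    {γ : hexGraph.Walk f f} (hγ : IsSiteInterfaceLoop (ω ∩ triMeshVertices (ball (0 : ℂ) r) δ) γ) :
    ‖(δ : ℂ) * hexCenter f‖ ≤ r + δ := by
  obtain ⟨d, hd, hfd⟩ := exists_dart_of_mem_support_of_isCycle hγ.isCycle (γ.start_mem_support)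
  obtain ⟨v, hv, h1, h2, -, -⟩ := hγ.exists_near_of_mem_darts hδ.le hd
  have hvr : ‖triMeshPoint δ v‖ < r := by
    have := mem_triMeshVertices_iff.1 hv
    rwa [mem_ball_zero_iff] at this
  have key : ∀ {p : ℂ}, p ∈ closedBall (triMeshPoint δ v) δ → ‖p‖ ≤ r + δ := by
    intro p hp
    rw [mem_closedBall, dist_eq_norm] at hp
    calc ‖p‖ = ‖p - triMeshPoint δ v + triMeshPoint δ v‖ := by rw [sub_add_cancel]
      _ ≤ ‖p - triMeshPoint δ v‖ + ‖triMeshPoint δ v‖ := norm_add_le _ _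
      _ ≤ δ + r := add_le_add hp hvr.le
      _ = r + δ := add_comm _ _
  rcases hfd with rfl | rfl
  exacts [key h1, key h2]

/-- **At positive mesh the generating set is finite**: an interface loop of the window configuration is determined
by its base face (`IsSiteInterfaceLoop.eq_of_base_eq`), which lies in the finite set of faces with centre in
`B̄(0, r + δ)` (`finite_setOf_norm_hexCenter_le`). -/
theorem finite_siteWinGen {δ : ℝ} (hδ : 0 < δ) (r : ℝ) (i : Fin 2) (ω : SiteConfig (Site 2)) :
    ({c : CurveClass ℂ | ∃ (f : HexVertex) (γ : hexGraph.Walk f f),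
      IsSiteInterfaceLoop (ω ∩ triMeshVertices (ball (0 : ℂ) r) δ) γ ∧
        (i = 1 ↔ 0 < shoelace (γ.support.map hexCenter)) ∧ c = siteLoopCurve δ γ}).Finite := by
  classical
  set ξ : SiteConfig (Site 2) := ω ∩ triMeshVertices (ball (0 : ℂ) r) δ with hξ
  -- THE loop of `ξ` through a face (junk: the trivial walk)
  let g : HexVertex → CurveClass ℂ := fun F ↦
    if h : ∃ w : hexGraph.Walk F F, IsSiteInterfaceLoop ξ w then siteLoopCurve δ h.choose
    else siteLoopCurve δ (SimpleGraph.Walk.nil : hexGraph.Walk F F)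
  refine ((finite_setOf_norm_hexCenter_le hδ (r + δ)).image g).subset ?_
  rintro c ⟨f, γ, hγ, -, rfl⟩
  refine ⟨f, norm_hexCenter_base_le hδ hγ, ?_⟩
  have hex : ∃ w : hexGraph.Walk f f, IsSiteInterfaceLoop ξ w := ⟨γ, hγ⟩
  change (if h : ∃ w : hexGraph.Walk f f, IsSiteInterfaceLoop ξ w then siteLoopCurve δ h.choose
    else siteLoopCurve δ (SimpleGraph.Walk.nil : hexGraph.Walk f f)) = siteLoopCurve δ γ
  rw [dif_pos hex, hex.choose_spec.eq_of_base_eq hγ]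

/-- At positive mesh the typed windowed collection IS its (finite) generating set. -/
theorem coe_siteWinColl {δ : ℝ} (hδ : 0 < δ) (r : ℝ) (i : Fin 2) (ω : SiteConfig (Site 2)) :
    ((Closeds.closure
      {c : CurveClass ℂ | ∃ (f : HexVertex) (γ : hexGraph.Walk f f),
      IsSiteInterfaceLoop (ω ∩ triMeshVertices (ball (0 : ℂ) r) δ) γ ∧
        (i = 1 ↔ 0 < shoelace (γ.support.map hexCenter)) ∧ c = siteLoopCurve δ γ} : LoopSpace ℂ) : Set (CurveClass ℂ)) =
    {c : CurveClass ℂ | ∃ (f : HexVertex) (γ : hexGraph.Walk f f),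
      IsSiteInterfaceLoop (ω ∩ triMeshVertices (ball (0 : ℂ) r) δ) γ ∧
        (i = 1 ↔ 0 < shoelace (γ.support.map hexCenter)) ∧ c = siteLoopCurve δ γ} := by
  change closure _ = _
  rw [(finite_siteWinGen hδ r i ω).isClosed.closure_eq]

/-- At positive mesh the typed windowed collection is a compact set of curve classes, all of them loops. -/
theorem isCompact_coe_siteWinColl {δ : ℝ} (hδ : 0 < δ) (r : ℝ) (i : Fin 2) (ω : SiteConfig (Site 2)) :
    IsCompact ((Closeds.closure
      {c : CurveClass ℂ | ∃ (f : HexVertex) (γ : hexGraph.Walk f f),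
      IsSiteInterfaceLoop (ω ∩ triMeshVertices (ball (0 : ℂ) r) δ) γ ∧
        (i = 1 ↔ 0 < shoelace (γ.support.map hexCenter)) ∧ c = siteLoopCurve δ γ} : LoopSpace ℂ) : Set (CurveClass ℂ)) := by
  rw [coe_siteWinColl hδ]
  exact (finite_siteWinGen hδ r i ω).isCompact

/-! ### Measurability and finite range at fixed mesh -/

/-- At fixed positive mesh the typed windowed collection is a measurable function of the configuration with
finitely many values: it factors through the restriction to the finitely many sites of the window
(`triMeshVertices_finite_holds`). -/
theorem measurable_and_finite_range_siteWinColl {δ : ℝ} (hδ : 0 < δ) (r : ℝ) (i : Fin 2) :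
    Measurable (fun ω : SiteConfig (Site 2) ↦ (Closeds.closure
      {c : CurveClass ℂ | ∃ (f : HexVertex) (γ : hexGraph.Walk f f),
      IsSiteInterfaceLoop (ω ∩ triMeshVertices (ball (0 : ℂ) r) δ) γ ∧
        (i = 1 ↔ 0 < shoelace (γ.support.map hexCenter)) ∧ c = siteLoopCurve δ γ} : LoopSpace ℂ)) ∧
    (Set.range fun ω : SiteConfig (Site 2) ↦ (Closeds.closure
      {c : CurveClass ℂ | ∃ (f : HexVertex) (γ : hexGraph.Walk f f),
      IsSiteInterfaceLoop (ω ∩ triMeshVertices (ball (0 : ℂ) r) δ) γ ∧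
        (i = 1 ↔ 0 < shoelace (γ.support.map hexCenter)) ∧ c = siteLoopCurve δ γ} : LoopSpace ℂ)).Finite := by
  set L : SiteConfig (Site 2) → LoopSpace ℂ := fun ω ↦ (Closeds.closure
      {c : CurveClass ℂ | ∃ (f : HexVertex) (γ : hexGraph.Walk f f),
      IsSiteInterfaceLoop (ω ∩ triMeshVertices (ball (0 : ℂ) r) δ) γ ∧
        (i = 1 ↔ 0 < shoelace (γ.support.map hexCenter)) ∧ c = siteLoopCurve δ γ} : LoopSpace ℂ) with hL
  set S : Set (Site 2) := triMeshVertices (ball (0 : ℂ) r) δ with hS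
  haveI : Finite S := (triMeshVertices_finite_holds isBounded_ball hδ).to_subtype
  let ρ : SiteConfig (Site 2) → Set S := fun ω ↦ {x : S | (x : Site 2) ∈ ω}
  let g : Set S → LoopSpace ℂ := fun A ↦ L (Subtype.val '' A)
  have hρ : Measurable ρ := measurable_set_iff.2 fun x ↦ measurable_set_mem (x : Site 2)
  have hg : Measurable g := measurable_of_countable g
  have hfac : L = g ∘ ρ := by
    funext ω
    simp only [hL, Function.comp_apply]
    rw [siteWinGen_eq_of_inter_eq (ω' := Subtype.val '' ρ ω)]
    change ω ∩ S = Subtype.val '' {x : S | (x : Site 2) ∈ ω} ∩ S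
    rw [image_val_setOf_mem_eq_inter, Set.inter_assoc, Set.inter_self]
  rw [hfac]
  refine ⟨hg.comp hρ, (Set.finite_range g).subset ?_⟩
  rintro _ ⟨ω, rfl⟩
  exact ⟨ρ ω, rfl⟩

/-! ### Locality: windowed typed collections versus the whole-plane typed configuration -/

/-- **Whole-plane typed loops inside the window are members of the windowed collection**: for `0 ≤ δ` and
`r' + δ ≤ r`, an unbased loop of type `i` of `siteLoopConfig δ ω` with trace in `B(0, r')` is the unbased loop of
a member of the typed windowed collection (`isSiteInterfaceLoop_inter_triMeshVertices_iff`). -/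
theorem exists_mem_siteWinColl_of_mem_siteLoopConfig {δ r r' : ℝ} (hδ : 0 ≤ δ) (hrr : r' + δ ≤ r)
    {ω : SiteConfig (Site 2)} {i : Fin 2} {u : UnbasedLoop ℂ} (hu : u ∈ (siteLoopConfig δ ω).F i)
    (hr : u.range ⊆ ball (0 : ℂ) r') :
    ∃ c ∈ (Closeds.closure
      {c : CurveClass ℂ | ∃ (f : HexVertex) (γ : hexGraph.Walk f f),
      IsSiteInterfaceLoop (ω ∩ triMeshVertices (ball (0 : ℂ) r) δ) γ ∧
        (i = 1 ↔ 0 < shoelace (γ.support.map hexCenter)) ∧ c = siteLoopCurve δ γ} : LoopSpace ℂ),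
      ∃ h : c.IsLoop, UnbasedLoop.mk (BasedLoop.mk c h) = u := by
  obtain ⟨v, γ, hγ, ht, rfl⟩ := mem_siteLoopConfig_iff.1 hu
  rw [range_mk_siteLoopCurve] at hr
  have hΩ : ball (0 : ℂ) (r' + δ) ⊆ ball 0 r := ball_subset_ball hrr
  refine ⟨siteLoopCurve δ γ, subset_closure ⟨v, γ, ?_, ht, rfl⟩, isLoop_siteLoopCurve δ γ, rfl⟩
  exact (isSiteInterfaceLoop_inter_triMeshVertices_iff hδ hΩ hr).2 hγ

/-- **Generators inside the window are whole-plane typed loops**: for `0 ≤ δ` and `r' + δ ≤ r`, a generator with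
trace in `B(0, r')` is (the class of) a loop of type `i` of `siteLoopConfig δ ω`. -/
theorem mk_mem_siteLoopConfig_of_mem_siteWinGen {δ r r' : ℝ} (hδ : 0 ≤ δ) (hrr : r' + δ ≤ r)
    {ω : SiteConfig (Site 2)} {i : Fin 2} {c : CurveClass ℂ}
    (hc : c ∈ {c : CurveClass ℂ | ∃ (f : HexVertex) (γ : hexGraph.Walk f f),
      IsSiteInterfaceLoop (ω ∩ triMeshVertices (ball (0 : ℂ) r) δ) γ ∧
        (i = 1 ↔ 0 < shoelace (γ.support.map hexCenter)) ∧ c = siteLoopCurve δ γ})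
    (hr : c.range ⊆ ball (0 : ℂ) r') :
    ∃ h : c.IsLoop, UnbasedLoop.mk (BasedLoop.mk c h) ∈ (siteLoopConfig δ ω).F i := by
  obtain ⟨v, γ, hγ, ht, rfl⟩ := hc
  have hΩ : ball (0 : ℂ) (r' + δ) ⊆ ball 0 r := ball_subset_ball hrr
  have hr' : Set.range (γ.toCurve fun w ↦ (δ : ℂ) * hexCenter w) ⊆ ball (0 : ℂ) r' := by
    rwa [← range_mk_siteLoopCurve δ γ]
  exact ⟨isLoop_siteLoopCurve δ γ, mem_siteLoopConfig_iff.2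
    ⟨v, γ, (isSiteInterfaceLoop_inter_triMeshVertices_iff hδ hΩ hr').1 hγ, ht, rfl⟩⟩

end SoftMachine

/-! ### Tightness of the typed windowed collections -/

/-- **Registered anchor** (`softMachine_isTightLaws_siteWinColl`): for every window radius `r` and type `i`, the
laws of the typed windowed loop collections of critical site percolation, `δ ∈ (0, 1]`, form a tight family on the
Aizenman–Burchard space `LoopSpace ℂ` — the Aizenman–Burchard criterion for systems of random curves
(`LoopSpace.isTightLaws_map_of_traversalBounds`, Duke Math. J. 99 (1999) Thm 1.2) applied, exactly as in
`isTightLaws_map_triLoopCollection_holds`, to the system of ALL interface polygons of the window configuration,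
which generates each typed sub-collection. -/
theorem softMachine_isTightLaws_siteWinColl : ∀ (r : ℝ) (i : Fin 2),
    IsTightLaws fun δ ↦ (triSitePercolation half).map fun ω ↦ Closeds.closure
      {c : CurveClass ℂ | ∃ (f : HexVertex) (γ : hexGraph.Walk f f),
        IsSiteInterfaceLoop (ω ∩ triMeshVertices (ball (0 : ℂ) r) δ) γ ∧
          (i = 1 ↔ 0 < shoelace (γ.support.map hexCenter)) ∧ c = siteLoopCurve δ γ} := by
  intro r i
  obtain ⟨k₁, K, lam, hK, hlam, hH1⟩ := triSitePercolation_exists_loop_hasTraversals_le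
  set k₀ : ℕ := 2 * (((2 * 14 + 1) ^ 2 * 2) ^ 2 + 1) + 1 with hk₀
  set r₀ : ℝ := max r 0 + 1 with hr₀
  have hr₀0 : 0 ≤ r₀ := by positivity
  have hr' : ball (0 : ℂ) r ⊆ closedBall (0 : ℂ) (max r 0) :=
    ball_subset_closedBall.trans (closedBall_subset_closedBall (le_max_left _ _))
  -- the random sets of interface polygons of the window configuration
  set X : ℝ → SiteConfig (Site 2) → Set (Curve ℂ) := fun δ ω ↦
    {γ | ∃ (f₀ : HexVertex) (w : hexGraph.Walk f₀ f₀),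
      IsSiteInterfaceLoop (ω ∩ triMeshVertices (ball (0 : ℂ) r) δ) w ∧ γ = hexLoopCurve δ w} with hX
  refine LoopSpace.isTightLaws_map_of_traversalBounds (E := ℂ) (isCompact_closedBall (0 : ℂ) r₀)
    (C := 9 * (r₀ + 2) ^ 2) (d := 2) zero_le_two
    (fun ρ hρ hρ1 ↦ exists_finset_card_le_cover_closedBall hr₀0 ρ hρ hρ1)
    (Ω := fun _ ↦ SiteConfig (Site 2)) (fun _ ↦ triSitePercolation half) X _
    (fun _ _ _ ↦ max k₀ k₁) hK hlam ?_ ?_ ?_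
  · -- each typed collection is generated by interface polygons of the window configuration
    intro δ _ ω c hc
    refine closure_mono ?_ hc
    rintro _ ⟨f, γ, hγ, -, rfl⟩
    exact ⟨hexLoopCurve δ γ, ⟨f, γ, hγ, rfl⟩, rfl⟩
  · -- (H0)
    rintro δ ⟨hδ0, hδ1⟩
    refine ae_of_all _ fun ω γ hγ ↦ ?_
    obtain ⟨f, w, hw, rfl⟩ := hγ
    refine ⟨?_, fun x ρ R hρ hρδ hρR htr ↦ ?_⟩
    · exact (hw.range_hexLoopCurve_subset hδ0.le hr').trans (closedBall_subset_closedBall (by rw [hr₀]; linarith))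
    · exact hw.not_hasTraversals_of_le hδ0 hρδ hρR (htr.of_le (le_max_left _ _))
  · -- (H1)
    intro δ hδ x ρ R hδρ hρR hR1
    refine le_trans (measure_mono ?_) (hH1 (triMeshVertices (ball (0 : ℂ) r) δ) δ hδ x ρ R hδρ hρR hR1)
    rintro ω ⟨γ, ⟨f, w, hw, rfl⟩, htr⟩
    exact ⟨f, w, hw, htr.of_le (le_max_right _ _)⟩

end Summit.CriticalPhenomena.CardyFormulaZ2.Cruxes.NestingRigidity.PositiveConeWeightDoubling

end
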